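import Summits.AtomisticToContinuum.HydrodynamicLimit.Theses.TwoClocks

/-!
# `ClampedEntropyClock` (stmt-AtomisticToContinuum-15145): a refutation would refute the summit conjunct (negative helper file; no Theses declaration is asserted; see `Cruxes/ClampedEntropyClock/Disproof.lean` §1; refuter-cdisprove-stmt-AtomisticToContinuum-15145-0)

The crux is the implication `KineticWindowLDUniform → EquilibriumClampedCollisionalWindowLD →
CollisionActivityTails → EnergyCurrentTails → DiluteSelfConsistency → HydrodynamicLimit` whose conclusion is
the sub-problem Statement. Two pure-logic facts, recorded as the kernel-checked reason the standing disprover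
reports "no kill":

* `not_hydrodynamicLimit_of_not_clampedEntropyClock` — any refutation of the crux is a refutation of the
  summit conjunct `HydrodynamicLimit`;
* `not_clampedEntropyClock_iff` — exactly: `¬ ClampedEntropyClock` holds iff the five open-problem-grade inputs
  hold AND `HydrodynamicLimit` fails.

Consequently the crux can only die through its parts (a refuted antecedent makes it VACUOUSLY TRUE, which is a
prover's ex-falso landing and a planner's restatement, not a refutation): see the Disproof file §2 for the live
instance (antecedent `EquilibriumClampedCollisionalWindowLD`, energy row, stmt-13733).

Dependency-drift repair (2026-08-17; statements, content and proofs of the two lemmas unchanged): at route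
rev 10 (2026-08-16T20:17:18Z, after the Lean refutation of stmt-13733) the route declarations
`…Theses.TwoClocks.ClampedEntropyClock` (stmt-15145, closed vacuously by `clampedEntropyClock_proof`),
`…Theses.TwoClocks.EquilibriumClampedCollisionalWindowLD` (stmt-13733, refuted) and
`…Theses.TwoClocks.CollisionActivityTails` (stmt-13734) were RESTATED as `TransferEntropyClock` (stmt-16625),
`ClampedTransferWindowLD` (stmt-16623) and `TransferActivityTails` (stmt-16624) and no longer exist under their
old names; their ledger signatures are recorded below verbatim as local definitions in the sub-namespace
`Retired15145` (opened), over the unchanged route declarations `KineticWindowLDUniform` (stmt-14442),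
`EnergyCurrentTails` (stmt-9235) and `DiluteSelfConsistency` (stmt-3091), so that both lemmas keep reading
verbatim as landed.  The same two pure-logic facts hold, with the same proofs, for the restated crux
`TransferEntropyClock` (same implication shape over the repaired antecedents).
-/

namespace Summit.AtomisticToContinuum.HydrodynamicLimit.Theorems

namespace ClampedEntropyClockNegative

open Summit.AtomisticToContinuum.HydrodynamicLimit.Theses.TwoClocks

/-! ### Records of the retired route declarations (verbatim ledger signatures) -/

section Records

open scoped BigOperators Topology Classical MeasureTheory ProbabilityTheory InnerProductSpace
open Filter Set Function MeasureTheory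

/-- **RECORD of the retired crux `EquilibriumClampedCollisionalWindowLD` (stmt-AtomisticToContinuum-13733;
verbatim its ledger signature).**  Clamped collisional-transfer window LD at global equilibrium, EOS-projected,
momentum-activity clamp `ω_i = 1{a_i ≤ V}`; REFUTED in Lean 2026-08-16 (energy row, frozen line-lattice
Newton-cradle witness, `Theorems.TwoClocksEquilibriumClampedCollisionalWindowLD_refuted` @ 8061795fe1a3) and
restated at route rev 10 as `ClampedTransferWindowLD` (stmt-16623, transfer-activity clamp).  Kept only so that
the retired clock crux below reads verbatim. -/
def Retired15145.EquilibriumClampedCollisionalWindowLD : Prop :=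
  ∃ σ₀ : ℝ, 0 < σ₀ ∧ ∀ (a₀ θ₀ : ℝ) (u₀ : Literature.MathematicalPhysics.KineticTheory.V3), 0 < a₀ → 0 < θ₀ → ∀ σ : ℝ, 0 < σ → σ < σ₀ → ∀ Φ : (N : ℕ) → Literature.Analysis.FluidPDE.HardSphereFlow (Literature.Analysis.FluidPDE.Torus.geometry (Fin 3)) (Literature.MathematicalPhysics.KineticTheory.hsDiameter σ N) (N + 1), ∀ φ : Literature.MathematicalPhysics.KineticTheory.T3 → ℝ, Literature.Analysis.FunctionSpaces.Torus.IsSmooth φ → ∃ V₀ : ℝ, 0 < V₀ ∧ ∀ V : ℝ, V₀ ≤ V → ∃ β₀ : ℝ, 0 < β₀ ∧ ∀ β : ℝ, |β| ≤ β₀ → ∀ ε : ℝ, 0 < ε → ∃ τ₀ : ℝ, 0 < τ₀ ∧ ∀ τ : ℝ, τ₀ ≤ τ → ∃ N₀ : ℕ, ∀ N : ℕ, N₀ ≤ N → (let w : ℝ := τ * ((N : ℝ) + 1) ^ (-(1 / 3 : ℝ)); let P := Literature.MathematicalPhysics.KineticTheory.localGibbsLaw σ (fun _ => a₀) (fun _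 => u₀) (fun _ => θ₀) N (Φ N); let Z : ℝ := Literature.MathematicalPhysics.KineticTheory.hsCompressibility (σ ^ 3); let Z' : ℝ := deriv Literature.MathematicalPhysics.KineticTheory.hsCompressibility (σ ^ 3); let act := fun (i : Fin (N + 1)) (z : Literature.Analysis.FluidPDE.Config (N + 1) (Fin 3) Literature.MathematicalPhysics.KineticTheory.T3) => σ / τ * (Φ N).collisionSum (Set.Ioc 0 w) (fun c => if c.fst = i then ‖c.postVel.1 - c.preVel.1‖ else 0) z; let ω := fun (i : Fin (N + 1)) (z : Literature.Analysis.FluidPDE.Config (N + 1) (Fin 3) Literature.MathematicalPhysics.KineticTheory.T3) => if act i z ≤ V then (1 : ℝ) else 0; let Xm := fun (k : Fin 3) (z : Literature.Analysis.FluidPDE.Config (N + 1) (Fin 3) Literature.MathematicalPhysics.KineticTheory.T3) => (Φ N).collisionSum (Set.Ioc 0 w) (fun c => ω c.fst z * ω c.snd z * ((φ c.fstPos - φ c.sndPos) * (c.postVel.1 k - c.preVel.1 k)) / 2) z; let Am := fun (k : Fin 3) (z : Literature.Analysis.FluidPDE.Config (N + 1) (Fin 3) Literature.MathematicalPhysics.KineticTheory.T3)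 => ∫ r in (0 : ℝ)..w, ∑ i, Literature.Analysis.FunctionSpaces.Torus.partialDeriv k φ ((Φ N).flow r z i).1 * (θ₀ * σ ^ 3 * Z' + (1 / 3) * (Z - 1) * ‖((Φ N).flow r z i).2 - u₀‖ ^ 2); let Xe := fun (z : Literature.Analysis.FluidPDE.Config (N + 1) (Fin 3) Literature.MathematicalPhysics.KineticTheory.T3) => (Φ N).collisionSum (Set.Ioc 0 w) (fun c => ω c.fst z * ω c.snd z * ((φ c.fstPos - φ c.sndPos) * ((‖c.postVel.1‖ ^ 2 - ‖c.preVel.1‖ ^ 2) / 2)) / 2) z; let Ae := fun (z : Literature.Analysis.FluidPDE.Config (N + 1) (Fin 3) Literature.MathematicalPhysics.KineticTheory.T3) => ∫ r in (0 : ℝ)..w, ∑ i, ((∑ l, u₀ l * Literature.Analysis.FunctionSpaces.Torus.partialDeriv l φ ((Φ N).flow r z i).1) * (θ₀ * σ ^ 3 * Z' + (1 / 3) * (Z - 1) * ‖((Φ N).flow r z i).2 - u₀‖ ^ 2) + θ₀ * (Z - 1) * (∑ l, Literature.Analysis.FunctionSpaces.Torus.partialDeriv l φ ((Φ N).flow r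 z i).1 * (((Φ N).flow r z i).2 - u₀) l)); (∀ k : Fin 3, ∫⁻ z, ENNReal.ofReal (Real.exp (β * (w⁻¹ * Xm k z - w⁻¹ * Am k z))) ∂P ≤ ENNReal.ofReal (Real.exp (ε * ((N : ℝ) + 1)))) ∧ ∫⁻ z, ENNReal.ofReal (Real.exp (β * (w⁻¹ * Xe z - w⁻¹ * Ae z))) ∂P ≤ ENNReal.ofReal (Real.exp (ε * ((N : ℝ) + 1))))

/-- **RECORD of the retired crux `CollisionActivityTails` (stmt-AtomisticToContinuum-13734; verbatim its
ledger signature).**  A-priori `L¹` tails of the window collisional (momentum) activity under the true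
evolution from local Gibbs data; restated at route rev 10 as `TransferActivityTails` (stmt-16624, same shape
with the transfer activity).  Kept only so that the retired clock crux below reads verbatim. -/
def Retired15145.CollisionActivityTails : Prop :=
  ∀ (a₀ θ₀ : Literature.MathematicalPhysics.KineticTheory.T3 → ℝ) (u₀ : Literature.MathematicalPhysics.KineticTheory.T3 → Literature.MathematicalPhysics.KineticTheory.V3), Continuous a₀ → Continuous θ₀ → Continuous u₀ → (∀ x, 0 < a₀ x) → (∀ x, 0 < θ₀ x) → ∃ σ₀ : ℝ, 0 < σ₀ ∧ ∀ σ : ℝ, 0 < σ → σ < σ₀ → ∀ (T : ℝ) (ρ θ : ℝ → Literature.MathematicalPhysics.KineticTheory.T3 → ℝ) (u : ℝ → Literature.MathematicalPhysics.KineticTheory.T3 → Literature.MathematicalPhysics.KineticTheory.V3), Literature.MathematicalPhysics.KineticTheory.IsHardSphereEulerSolution σ T ρ u θ → ∀ Φ : (N : ℕ) → Literature.Analysis.FluidPDE.HardSphereFlow (Literature.Analysis.FluidPDE.Torus.geometry (Fin 3)) (Literature.MathematicalPhysics.KineticTheory.hsDiameter σ N) (N + 1), Literature.MathematicalPhysics.KineticTheory.TendstoHydroFieldsAt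 (fun N => Literature.MathematicalPhysics.KineticTheory.localGibbsLaw σ a₀ u₀ θ₀ N (Φ N)) Φ ρ u θ 0 → ∀ t ∈ Set.Ico 0 T, ∃ V₀ : ℝ, 0 < V₀ ∧ ∀ V : ℝ, V₀ ≤ V → ∀ ε : ℝ, 0 < ε → ∃ τ₀ : ℝ, 0 < τ₀ ∧ ∀ τ : ℝ, τ₀ ≤ τ → ∃ N₀ : ℕ, ∀ N : ℕ, N₀ ≤ N → ∀ s ∈ Set.Icc 0 t, (let w : ℝ := τ * ((N : ℝ) + 1) ^ (-(1 / 3 : ℝ)); let P := Literature.MathematicalPhysics.KineticTheory.localGibbsLaw σ a₀ u₀ θ₀ N (Φ N); let act := fun (i : Fin (N + 1)) (z : Literature.Analysis.FluidPDE.Config (N + 1) (Fin 3) Literature.MathematicalPhysics.KineticTheory.T3) => σ / τ * (Φ N).collisionSum (Set.Ioc s (s + w)) (fun c => if c.fst = i then ‖c.postVel.1 - c.preVel.1‖ else 0) z; ∫⁻ z, ENNReal.ofReal (((N : ℝ) + 1)⁻¹ * ∑ i : Fin (N + 1), Set.indicator {y : ℝ | V < y} (fun y => y) (act i z)) ∂P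 ≤ ENNReal.ofReal ε)

end Records

/-- **RECORD of the retired crux `ClampedEntropyClock` (stmt-AtomisticToContinuum-15145; verbatim its ledger
signature)**, over the unchanged route declarations `KineticWindowLDUniform`, `EnergyCurrentTails`,
`DiluteSelfConsistency` of `Theses/TwoClocks.lean` and the two records above.  The route declaration
`…Theses.TwoClocks.ClampedEntropyClock` was closed VACUOUSLY (`clampedEntropyClock_proof`, ex falso from the
refutation of its second antecedent stmt-13733) and restated at route rev 10 (2026-08-16T20:17:18Z) as
`TransferEntropyClock` (stmt-16625); it no longer exists under this name.  Opened below, so the two lemmas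
read verbatim as landed. -/
def Retired15145.ClampedEntropyClock : Prop :=
  KineticWindowLDUniform → Retired15145.EquilibriumClampedCollisionalWindowLD →
    Retired15145.CollisionActivityTails → EnergyCurrentTails → DiluteSelfConsistency → _root_.HydrodynamicLimit

open Retired15145 (ClampedEntropyClock EquilibriumClampedCollisionalWindowLD CollisionActivityTails)

/-! ### The two pure-logic facts -/

/-- **Any refutation of the crux `ClampedEntropyClock` refutes the summit conjunct**: the crux is an
implication concluding `HydrodynamicLimit`, hence implied by it. [folklore] -/
theorem not_hydrodynamicLimit_of_not_clampedEntropyClock (h : ¬ ClampedEntropyClock) :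
    ¬ _root_.HydrodynamicLimit := by
  intro hHL
  apply h
  unfold ClampedEntropyClock
  intro _ _ _ _ _
  exact hHL

/-- **The refutation problem for `ClampedEntropyClock`, exactly**: its negation is equivalent to the
conjunction of its five antecedents (the docking node, the clamped collisional window LD, the two a-priori tail
inputs, dilute self-consistency — each open-problem grade) with the NEGATION of the summit conjunct. [folklore] -/
theorem not_clampedEntropyClock_iff :
    ¬ ClampedEntropyClock ↔
      (KineticWindowLDUniform ∧ EquilibriumClampedCollisionalWindowLD ∧ CollisionActivityTails ∧
        EnergyCurrentTails ∧ DiluteSelfConsistency ∧ ¬ _root_.HydrodynamicLimit) := by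
  unfold ClampedEntropyClock
  constructor
  · intro h
    by_contra hc
    apply h
    intro hK h₃ h₇ h₆ hS
    by_contra hHL
    exact hc ⟨hK, h₃, h₇, h₆, hS, hHL⟩
  · rintro ⟨hK, h₃, h₇, h₆, hS, hHL⟩ hC
    exact hHL (hC hK h₃ h₇ h₆ hS)

end ClampedEntropyClockNegative

end Summit.AtomisticToContinuum.HydrodynamicLimit.Theorems
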